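import Summits.QuantumFields.QCD.Theorems.HeatSlicedQuarksQuarkLoopCoefficientSecondOrderExpansionAuxF

/-!
# Second-order expansion of the heat symbol — part G: `e2 t = tr E₂(t)(0)`
(line `Sketch` of crux stmt-QuantumFields-16786, stub `stub_secondOrderExpansion`, helper file)

The explicit second-order coefficient `e2 t` of the Defs file (a time integral of a lattice series of
traces) equals the spin trace at the origin of the closed-form second-order term `E₂cf(t)(0)` of part F
(`t > 0`): trace/series interchange for the summable Duhamel integrand, evenness of the free kernel, and
the polynomial-in-`s` form of the collapsed integrand.
-/

noncomputable section

namespace Summit.QuantumFields.QCD.Cruxes.QuarkLoopCoefficient.Sketch.SecondOrderExpansion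

open Literature.MathematicalPhysics.QuantumLattice Literature.MathematicalPhysics.QuantumFieldTheory
open Literature.Probability.LatticeModels (Site)
open Summit.QuantumFields.QCD.Theorems.QuarkLoopCoefficient
open Summit.QuantumFields.QCD.Cruxes.QuarkLoopCoefficient.Sketch.HeatSeries
open Summit.QuantumFields.QCD.Cruxes.QuarkLoopCoefficient.Sketch.FreeMajorantToolkit
open scoped Matrix ComplexConjugate

/-- The first-order matrix kernel `η(v) = Σ_{z ∈ nbr 0} (z∧v) • ď♯(z) ď(v−z)` (local notation). -/
local notation "η[" v "]" => (∑ z ∈ nbr 0, ((wedge z v : ℤ) : ℂ) • (dsharp z * dsymb (v - z)))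

/-- The second-order matrix kernel `η'(v) = Σ_{z ∈ nbr 0} (z∧v)² • ď♯(z) ď(v−z)` (local notation). -/
local notation "η'[" v "]" => (∑ z ∈ nbr 0, (((wedge z v : ℤ) : ℂ) ^ 2) • (dsharp z * dsymb (v - z)))

/-! ## §16 The second-order coefficient `e2` is the trace of `E₂` at the origin -/

/-- Trace of a series of spin matrices against the (even) free kernel at the origin:
`Σ_α (freeConv u F 0)_{αα} = Σ_w k_u(w) tr F(w)` for a summable integrand. -/
theorem sum_freeConv_apply_diag_eq
    (h7 : ∀ (t : ℝ) (w : Site 4), freeKer t (-w) = freeKer t w)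
    (u : ℝ) (F : Site 4 → Spin)
    (hF : Summable (fun y : Site 4 => ((freeKer u (0 - y) : ℝ) : ℂ) • F y)) :
    ∑ α : Fin 4, freeConv u F 0 α α = ∑' w : Site 4, ((freeKer u w : ℝ) : ℂ) * (F w).trace := by
  unfold freeConv
  have e1 : ∀ α : Fin 4, (∑' y : Site 4, ((freeKer u (0 - y) : ℝ) : ℂ) • F y) α α =
      ∑' y : Site 4, (((freeKer u (0 - y) : ℝ) : ℂ) • F y) α α := by
    intro α
    have h1 : (∑' y : Site 4, ((freeKer u (0 - y) : ℝ) : ℂ) • F y) α =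
        ∑' y : Site 4, (((freeKer u (0 - y) : ℝ) : ℂ) • F y) α := tsum_apply hF
    have h2 : (∑' y : Site 4, (((freeKer u (0 - y) : ℝ) : ℂ) • F y) α) α =
        ∑' y : Site 4, (((freeKer u (0 - y) : ℝ) : ℂ) • F y) α α := tsum_apply (Pi.summable.mp hF α)
    rw [show (∑' y : Site 4, ((freeKer u (0 - y) : ℝ) : ℂ) • F y) α α =
      ((∑' y : Site 4, ((freeKer u (0 - y) : ℝ) : ℂ) • F y) α) α from rfl, h1, h2]
  simp_rw [e1]
  rw [← Summable.tsum_finsetSum (fun α _ => Pi.summable.mp (Pi.summable.mp hF α) α)]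
  refine tsum_congr fun y => ?_
  simp only [Matrix.smul_apply, smul_eq_mul, ← Finset.mul_sum, zero_sub, h7]
  rfl

/-- **`e2 t = tr E₂cf(t)(0)`** for `t > 0`: the explicit second-order coefficient of the Defs file is the
spin trace at the origin of the closed-form second-order term. -/
theorem e2_eq_trace_pert2_closed
    (h1 : ∀ x y : Site 4, sqKer (fun _ => (1 : ℂ)) x y = ((hhat (y - x) : ℝ) : ℂ) • (1 : Spin))
    (h3 : ∀ w : Site 4, freeKer 0 w = if w = 0 then 1 else 0)
    (h5 : ∀ s r : ℝ, 0 ≤ s → 0 ≤ r → ∀ w : Site 4,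
      HasSum (fun y : Site 4 => freeKer s y * freeKer r (w - y)) (freeKer (s + r) w))
    (h6 : ∀ t : ℝ, 0 ≤ t → ∀ (w : Site 4) (ν : Fin 4),
      t * (∑ z ∈ nbr2 0, ((z ν : ℤ) : ℝ) * hhat z * freeKer t (w - z)) + ((w ν : ℤ) : ℝ) * freeKer t w = 0)
    (h7 : ∀ (t : ℝ) (w : Site 4), freeKer t (-w) = freeKer t w)
    {t : ℝ} (ht : 0 < t) :
    e2 t = Matrix.trace (∑ v ∈ nbr2 0, ((t : ℂ) / 8 * ((freeKer t (0 - v) : ℝ) : ℂ)) • (∑ z ∈ nbr 0, (((wedge z v : ℤ) : ℂ) ^ 2) • (dsharp z * dsymb (v - z))) +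
        ∑ v ∈ nbr2 0, ((t : ℂ) / 8 * ((wedge v 0 : ℤ) : ℂ) * ((freeKer t (0 - v) : ℝ) : ℂ)) • (∑ z ∈ nbr 0, ((wedge z v : ℤ) : ℂ) • (dsharp z * dsymb (v - z))) +
        (((∑ v ∈ nbr2 0, hhat v * (t / 24 * (((wedge v 0 : ℤ) : ℝ) ^ 2 * freeKer t (0 - v)) -
          t ^ 2 / 48 *
            (((v 0 : ℤ) : ℝ) ^ 2 * ∑ z ∈ nbr2 0, ((z 1 : ℤ) : ℝ) * ((z 1 : ℤ) : ℝ) * hhat z * freeKer t (0 - v - z) -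
              2 * ((v 0 : ℤ) : ℝ) * ((v 1 : ℤ) : ℝ) *
                ∑ z ∈ nbr2 0, ((z 0 : ℤ) : ℝ) * ((z 1 : ℤ) : ℝ) * hhat z * freeKer t (0 - v - z) +
              ((v 1 : ℤ) : ℝ) ^ 2 * ∑ z ∈ nbr2 0, ((z 0 : ℤ) : ℝ) * ((z 0 : ℤ) : ℝ) * hhat z * freeKer t (0 - v - z))) : ℝ)) : ℂ) • (1 : Spin) +
        ∑ v ∈ nbr2 0, ∑ u ∈ nbr2 0, (-(t : ℂ) ^ 2 / 8 * ((freeKer t (0 - v - u) : ℝ) : ℂ)) • ((∑ z ∈ nbr 0, ((wedge z v : ℤ) : ℂ) • (dsharp z * dsymb (v - z))) * (∑ z ∈ nbr 0, ((wedge z u : ℤ) : ℂ) • (dsharp z * dsymb (u - z)))) +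
        ∑ v ∈ nbr2 0, ∑ u ∈ nbr2 0,
          (-(t : ℂ) ^ 2 / 8 * ((wedge v u : ℤ) : ℂ) * ((hhat v : ℝ) : ℂ) * ((freeKer t (0 - v - u) : ℝ) : ℂ)) • (∑ z ∈ nbr 0, ((wedge z u : ℤ) : ℂ) • (dsharp z * dsymb (u - z)))) := by
  have hA : Set.EqOn (fun s : ℝ => ∑' w : Site 4,
      ((freeKer (t - s) w : ℝ) : ℂ) * ((vtx 2 (pert0 s) w).trace + (vtx 1 (pert1 s) w).trace))
      (fun s : ℝ => ∑ α : Fin 4, ((∑ v ∈ nbr2 0, (-1 / 8 * ((freeKer t (0 - v) : ℝ) : ℂ)) • η'[v]) α α +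
        ((∑ v ∈ nbr2 0, (-1 / 4 / (t : ℂ) * ((wedge v 0 : ℤ) : ℂ) * ((freeKer t (0 - v) : ℝ) : ℂ)) • η[v] +
          (((∑ v ∈ nbr2 0, 1 / 8 * hhat v *
            (((v 0 : ℤ) : ℝ) ^ 2 * ∑ z ∈ nbr2 0, ((z 1 : ℤ) : ℝ) * ((z 1 : ℤ) : ℝ) * hhat z * freeKer t (0 - v - z) -
              2 * ((v 0 : ℤ) : ℝ) * ((v 1 : ℤ) : ℝ) *
                ∑ z ∈ nbr2 0, ((z 0 : ℤ) : ℝ) * ((z 1 : ℤ) : ℝ) * hhat z * freeKer t (0 - v - z) +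
              ((v 1 : ℤ) : ℝ) ^ 2 * ∑ z ∈ nbr2 0, ((z 0 : ℤ) : ℝ) * ((z 0 : ℤ) : ℝ) * hhat z * freeKer t (0 - v - z)) :
            ℝ)) : ℂ) • (1 : Spin) +
          ∑ v ∈ nbr2 0, ∑ u ∈ nbr2 0, (1 / 4 * ((freeKer t (0 - v - u) : ℝ) : ℂ)) • (η[v] * η[u]) +
          ∑ v ∈ nbr2 0, ∑ u ∈ nbr2 0,
            (1 / 4 * ((wedge v u : ℤ) : ℂ) * ((hhat v : ℝ) : ℂ) * ((freeKer t (0 - v - u) : ℝ) : ℂ)) • η[u])) α α * (s : ℂ) +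
        (((((∑ v ∈ nbr2 0, -1 / 8 * hhat v *
            ((((wedge v 0 : ℤ) : ℝ) ^ 2 * freeKer t (0 - v)) / t ^ 2 +
              (((v 0 : ℤ) : ℝ) ^ 2 * ∑ z ∈ nbr2 0, ((z 1 : ℤ) : ℝ) * ((z 1 : ℤ) : ℝ) * hhat z * freeKer t (0 - v - z) -
              2 * ((v 0 : ℤ) : ℝ) * ((v 1 : ℤ) : ℝ) *
                ∑ z ∈ nbr2 0, ((z 0 : ℤ) : ℝ) * ((z 1 : ℤ) : ℝ) * hhat z * freeKer t (0 - v - z) +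
              ((v 1 : ℤ) : ℝ) ^ 2 * ∑ z ∈ nbr2 0, ((z 0 : ℤ) : ℝ) * ((z 0 : ℤ) : ℝ) * hhat z * freeKer t (0 - v - z)) / t) :
            ℝ)) : ℂ) • (1 : Spin))) α α * (s : ℂ) ^ 2)) (Set.uIcc 0 t) := by
    intro s hs
    rw [Set.uIcc_of_le ht.le] at hs
    have HS := summable_freeKer_smul_forcing h1 h3 h5 h6 ht hs.1 hs.2 0
    have hsum := sum_freeConv_apply_diag_eq h7 (t - s) _ HS
    simp only [Matrix.trace_add] at hsum
    simp only
    rw [← hsum]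
    refine Finset.sum_congr rfl fun α _ => ?_
    rw [freeConv_forcing h1 h3 h5 h6 ht hs.1 hs.2 0, forcing_collapsed_eq_poly ht s 0]
    simp only [Matrix.add_apply, Matrix.smul_apply, smul_eq_mul]
    ring
  unfold e2
  rw [intervalIntegral.integral_congr hA,
    intervalIntegral.integral_finsetSum (fun α _ => (by fun_prop : Continuous fun s : ℝ => _).intervalIntegrable _ _)]
  simp only [integral_quadratic]
  rw [pert2_closed_eq_poly ht 0, Matrix.trace_neg, Matrix.trace_add, Matrix.trace_add, Matrix.trace_smul,
    Matrix.trace_smul, Matrix.trace_smul]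
  simp only [smul_eq_mul, Matrix.trace, Matrix.diag_apply]
  have key : ∀ a b c : Fin 4 → ℂ, -∑ α : Fin 4, (a α * (t : ℂ) + b α * (t : ℂ) ^ 2 / 2 + c α * (t : ℂ) ^ 3 / 3) =
      -((t : ℂ) * ∑ α : Fin 4, a α + (t : ℂ) ^ 2 / 2 * ∑ α : Fin 4, b α + (t : ℂ) ^ 3 / 3 * ∑ α : Fin 4, c α) := by
    intro a b c
    rw [Finset.mul_sum, Finset.mul_sum, Finset.mul_sum, ← Finset.sum_add_distrib, ← Finset.sum_add_distrib]
    congr 1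
    exact Finset.sum_congr rfl fun α _ => by ring
  exact key _ _ _

/-! ## Registered headline -/

/-- Registered headline of this helper file (aux stub `stub_secondOrderExpansionAuxG` of crux
stmt-QuantumFields-16786, line `Sketch`): `e2 t` is the trace at the origin of the closed-form `E₂`. -/
theorem stub_secondOrderExpansionAuxG : (∀ x y : Site 4, sqKer (fun _ => (1 : ℂ)) x y = ((hhat (y - x) : ℝ) : ℂ) • (1 : Spin)) → (∀ w : Site 4, freeKer 0 w = if w = 0 then 1 else 0) → (∀ s r : ℝ, 0 ≤ s → 0 ≤ r → ∀ w : Site 4, HasSum (fun y : Site 4 => freeKer s y * freeKer r (w - y)) (freeKer (s + r) w)) → (∀ t : ℝ, 0 ≤ t → ∀ (w : Site 4) (ν : Fin 4), t * (∑ z ∈ nbr2 0, ((z ν : ℤ) : ℝ) * hhat z * freeKer t (w - z)) + ((w ν : ℤ) : ℝ) * freeKer t w = 0) → (∀ (t : ℝ) (w : Site 4), freeKer t (-w) = freeKer t w) → ∀ (t : ℝ), 0 < t → e2 t = Matrix.trace (∑ v ∈ nbr2 0, ((t : ℂ) / 8 * ((freeKer t (0 - v) : ℝ) : ℂ)) •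 (∑ z ∈ nbr 0, (((wedge z v : ℤ) : ℂ) ^ 2) • (dsharp z * dsymb (v - z))) +
        ∑ v ∈ nbr2 0, ((t : ℂ) / 8 * ((wedge v 0 : ℤ) : ℂ) * ((freeKer t (0 - v) : ℝ) : ℂ)) • (∑ z ∈ nbr 0, ((wedge z v : ℤ) : ℂ) • (dsharp z * dsymb (v - z))) +
        (((∑ v ∈ nbr2 0, hhat v * (t / 24 * (((wedge v 0 : ℤ) : ℝ) ^ 2 * freeKer t (0 - v)) -
          t ^ 2 / 48 *
            (((v 0 : ℤ) : ℝ) ^ 2 * ∑ z ∈ nbr2 0, ((z 1 : ℤ) : ℝ) * ((z 1 : ℤ) : ℝ) * hhat z * freeKer t (0 - v - z) -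
              2 * ((v 0 : ℤ) : ℝ) * ((v 1 : ℤ) : ℝ) *
                ∑ z ∈ nbr2 0, ((z 0 : ℤ) : ℝ) * ((z 1 : ℤ) : ℝ) * hhat z * freeKer t (0 - v - z) +
              ((v 1 : ℤ) : ℝ) ^ 2 * ∑ z ∈ nbr2 0, ((z 0 : ℤ) : ℝ) * ((z 0 : ℤ) : ℝ) * hhat z * freeKer t (0 - v - z))) : ℝ)) : ℂ) • (1 : Spin) +
        ∑ v ∈ nbr2 0, ∑ u ∈ nbr2 0, (-(t : ℂ) ^ 2 / 8 * ((freeKer t (0 - v - u) : ℝ) : ℂ)) • ((∑ z ∈ nbr 0, ((wedge z v : ℤ) : ℂ) • (dsharp z * dsymb (v - z))) * (∑ z ∈ nbr 0, ((wedge z u : ℤ) : ℂ) • (dsharp z * dsymb (u - z)))) +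
        ∑ v ∈ nbr2 0, ∑ u ∈ nbr2 0,
          (-(t : ℂ) ^ 2 / 8 * ((wedge v u : ℤ) : ℂ) * ((hhat v : ℝ) : ℂ) * ((freeKer t (0 - v - u) : ℝ) : ℂ)) • (∑ z ∈ nbr 0, ((wedge z u : ℤ) : ℂ) • (dsharp z * dsymb (u - z)))) :=
  fun h1 h3 h5 h6 h7 _ ht => e2_eq_trace_pert2_closed h1 h3 h5 h6 h7 ht

end Summit.QuantumFields.QCD.Cruxes.QuarkLoopCoefficient.Sketch.SecondOrderExpansion

end
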